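import Summits.AtomisticToContinuum.HydrodynamicLimit.Theorems.AntiMazurCoboundariesInfluenceLocalityTightChainTail
import Summits.AtomisticToContinuum.HydrodynamicLimit.Theorems.AntiMazurCoboundariesInfluenceLocalityForecastWorldsGood
import Summits.AtomisticToContinuum.HydrodynamicLimit.Theorems.AntiMazurCoboundariesInfluenceLocalityEnergyDomination
import HarnessLib

/-!
# First-moment influence locality MODULO the forecast cap (crux `InfluenceLocality`, stmt-AtomisticToContinuum-13916;
# route AntiMazurCoboundaries; line `slab-percolation-shadow`, lead a1)

`firstMoment_of_stubs`: the four landed stub statements of the dead line `true-anchored-infection`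
(`ForecastWorldsGood`, `EnergyDomination`, `AnchoredCovering`, `TrueCapsExist`), the forecast cap `ForecastCapsExist`
(= `G_free`, OPEN) and the landed `TightChainTail` imply the restatement (A) `FirstMomentInfluenceLocality` of the crux
(first moment, eventual in `R`, uniform in `N`). Hence the registered goal
`firstMoment_of_forecastCaps : ForecastCapsExist → FirstMomentInfluenceLocality` — the re-typed crux CLOSED MODULO ONE NAMED
STUB, `G_free` (backward-cluster cardinality tail of the free isolated Gibbs droplet; deleted by a walled re-typing of the forecast,
see the crux's `RETYPE.md` / `PICKED.md`).

Composition: a.e. `bad ⊆ hot ∪ gathering ∪ (tight chain ∧ ¬hot)` (energy domination turns "no gathering + capped initial data"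
into the forecast cap `w = u√M`); `#bad ≤ Σ_i` of the three measurable-hull indicators (`badCount_le_sum_indicator`,
`lintegral_sum_indicator_eq` — no measurability of the raw events is needed); each probability `≤ ε/3`.
-/

namespace Summit.AtomisticToContinuum.HydrodynamicLimit.Theorems.TrueAnchoredInfection

open MeasureTheory Set
open scoped Classical ENNReal
open Literature.Analysis.FluidPDE Literature.MathematicalPhysics.KineticTheory

noncomputable section

/-- CAP ARITHMETIC: for `(α + β + 1)² ≤ R` (with `α, β ≥ 0`) one has `α √R + β ≤ R`. -/
theorem sqrt_budget' {α β R : ℝ} (hα : 0 ≤ α) (hβ : 0 ≤ β) (hR : (α + β + 1) ^ 2 ≤ R) :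
    α * Real.sqrt R + β ≤ R := by
  have hR0 : 0 ≤ R := le_trans (sq_nonneg _) hR
  have hs : α + β + 1 ≤ Real.sqrt R := by
    rw [← Real.sqrt_sq (by positivity : 0 ≤ α + β + 1)]
    exact Real.sqrt_le_sqrt hR
  have hs1 : 1 ≤ Real.sqrt R := by linarith
  have hRR : Real.sqrt R * Real.sqrt R = R := Real.mul_self_sqrt hR0
  nlinarith [mul_le_mul_of_nonneg_right hs (Real.sqrt_nonneg R)]

/-- COUNTING through measurable hulls: if every bad particle lies in one of three events, `#bad` is at most the
sum over labels of the three indicator functions of their measurable hulls. -/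
theorem badCount_le_sum_indicator {σ T R : ℝ} {N : ℕ} {Φ : Flow σ N} {Ψ : ClusterFlows σ N}
    (μ : Measure (Phase N)) (A B C : Fin (N + 1) → Set (Phase N)) {z : Phase N}
    (h : ∀ i, IsBad σ T R N Φ Ψ z i → z ∈ A i ∨ z ∈ B i ∨ z ∈ C i) :
    (badCount σ T R N Φ Ψ z : ℝ≥0∞) ≤
      ∑ i : Fin (N + 1), ((toMeasurable μ (A i)).indicator 1 z + (toMeasurable μ (B i)).indicator 1 z +
        (toMeasurable μ (C i)).indicator 1 z) := by
  rw [badCount_eq, Finset.card_filter]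
  push_cast
  refine Finset.sum_le_sum fun i _ => ?_
  by_cases hb : IsBad σ T R N Φ Ψ z i
  · rw [if_pos hb]
    rcases h i hb with hz | hz | hz
    · have : (toMeasurable μ (A i)).indicator (1 : Phase N → ℝ≥0∞) z = 1 :=
        Set.indicator_of_mem (subset_toMeasurable μ _ hz) _
      rw [this]
      exact le_add_right (le_add_right le_rfl)
    · have : (toMeasurable μ (B i)).indicator (1 : Phase N → ℝ≥0∞) z = 1 :=
        Set.indicator_of_mem (subset_toMeasurable μ _ hz) _
      rw [this]
      exact le_add_right (le_add_left le_rfl)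
    · have : (toMeasurable μ (C i)).indicator (1 : Phase N → ℝ≥0∞) z = 1 :=
        Set.indicator_of_mem (subset_toMeasurable μ _ hz) _
      rw [this]
      exact le_add_left le_rfl
  · rw [if_neg hb]
    exact bot_le

/-- INTEGRATING the hull indicators: `∫ Σ_i (1_{Ā_i} + 1_{B̄_i} + 1_{C̄_i}) dμ = Σ_i (μ A_i + μ B_i + μ C_i)`. -/
theorem lintegral_sum_indicator_eq {N : ℕ} (μ : Measure (Phase N)) (A B C : Fin (N + 1) → Set (Phase N)) :
    ∫⁻ z, ∑ i : Fin (N + 1), ((toMeasurable μ (A i)).indicator 1 z + (toMeasurable μ (B i)).indicator 1 z +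
        (toMeasurable μ (C i)).indicator 1 z) ∂μ = ∑ i : Fin (N + 1), (μ (A i) + μ (B i) + μ (C i)) := by
  set F : Fin (N + 1) → Phase N → ℝ≥0∞ := fun i z => (toMeasurable μ (A i)).indicator 1 z +
    (toMeasurable μ (B i)).indicator 1 z + (toMeasurable μ (C i)).indicator 1 z with hF
  have hA : ∀ i, Measurable fun z => (toMeasurable μ (A i)).indicator (1 : Phase N → ℝ≥0∞) z :=
    fun i => measurable_one.indicator (measurableSet_toMeasurable μ _)
  have hB : ∀ i, Measurable fun z => (toMeasurable μ (B i)).indicator (1 : Phase N → ℝ≥0∞) z :=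
    fun i => measurable_one.indicator (measurableSet_toMeasurable μ _)
  have hC : ∀ i, Measurable fun z => (toMeasurable μ (C i)).indicator (1 : Phase N → ℝ≥0∞) z :=
    fun i => measurable_one.indicator (measurableSet_toMeasurable μ _)
  have hFm : ∀ i, Measurable (F i) := fun i => ((hA i).add (hB i)).add (hC i)
  have hint : ∀ i, ∫⁻ z, F i z ∂μ = μ (A i) + μ (B i) + μ (C i) := by
    intro i
    have hAB : Measurable fun z => (toMeasurable μ (A i)).indicator (1 : Phase N → ℝ≥0∞) z +
        (toMeasurable μ (B i)).indicator (1 : Phase N → ℝ≥0∞) z := (hA i).add (hB i)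
    change ∫⁻ z, ((toMeasurable μ (A i)).indicator 1 z + (toMeasurable μ (B i)).indicator 1 z +
      (toMeasurable μ (C i)).indicator 1 z) ∂μ = _
    rw [lintegral_add_left hAB, lintegral_add_left (hA i),
      lintegral_indicator_one (measurableSet_toMeasurable μ _),
      lintegral_indicator_one (measurableSet_toMeasurable μ _),
      lintegral_indicator_one (measurableSet_toMeasurable μ _),
      measure_toMeasurable, measure_toMeasurable, measure_toMeasurable]
  calc ∫⁻ z, ∑ i : Fin (N + 1), F i z ∂μ = ∑ i : Fin (N + 1), ∫⁻ z, F i z ∂μ :=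
        lintegral_finsetSum _ fun i _ => hFm i
    _ = _ := Finset.sum_congr rfl fun i _ => hint i

/-- **COMPOSITION (first moments).** The four landed stub statements, `ForecastCapsExist` and `TightChainTail`
imply `FirstMomentInfluenceLocality`. Order of choices: `σ₀ := min (…) (1/2)`; given `σ, T, ε`: the genuine
admissible caps `u(·), M(·)` (stubs `TrueCapsExist`, `ForecastCapsExist`) with their tails at `ε/3`; the chain
schedule `w := u√M`; the chain tail at `ε/3`; `R₀ := max` of the three ranges, the admissibility ranges and the
budget range `(4T√θ + 6σ + 4T‖u₀‖ + 1)²`; `K := ⌈R/(4σ)⌉`; `N₀ := max`. Then a.e.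
`bad ⊆ hot ∪ gathering ∪ (chain ∧ ¬hot)` (`stub_forecastWorldsGood`, `stub_energyDomination`,
`stub_anchoredCovering`, exactly as in the dead line's `eventually_of_stubs`), `#bad ≤ Σ_i` of three hull indicators,
and the three probabilities are `≤ ε/3` each. -/
theorem firstMoment_of_stubs :
    ForecastWorldsGood → EnergyDomination → AnchoredCovering → TrueCapsExist →
      ForecastCapsExist → TightChainTail → FirstMomentInfluenceLocality := by
  intro hGood hDom hCov hTrue hFcst hTail a θ u₀ ha hθ
  obtain ⟨σ₂, hσ₂, h2⟩ := hTrue a θ u₀ ha hθ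
  obtain ⟨σ₃, hσ₃, h3⟩ := hFcst a θ u₀ ha hθ
  obtain ⟨σ₄, hσ₄, h4⟩ := hTail a θ u₀ ha hθ
  refine ⟨min (min σ₂ (min σ₃ σ₄)) (1 / 2), by positivity, ?_⟩
  intro σ hσ hσlt T ε hT hε
  have hm : min (min σ₂ (min σ₃ σ₄)) (1 / 2) ≤ min σ₂ (min σ₃ σ₄) := min_le_left _ _
  have hσ₂' : σ < σ₂ := lt_of_lt_of_le hσlt (hm.trans (min_le_left _ _))
  have hσ₃' : σ < σ₃ := lt_of_lt_of_le hσlt (hm.trans ((min_le_right _ _).trans (min_le_left _ _)))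
  have hσ₄' : σ < σ₄ := lt_of_lt_of_le hσlt (hm.trans ((min_le_right _ _).trans (min_le_right _ _)))
  have hσhalf : σ ≤ 1 / 2 := (le_of_lt hσlt).trans (min_le_right _ _)
  have hε3 : 0 < ε / 3 := by positivity
  -- genuine caps
  obtain ⟨u, huA, huT⟩ := h2 σ hσ hσ₂' T hT
  obtain ⟨M, hMA, hMT⟩ := h3 σ hσ hσ₃' T hT
  obtain ⟨Ra, hRa, hua⟩ := huA
  obtain ⟨Rb, hRb, hMb⟩ := hMA
  -- the chain schedule w := u √M
  obtain ⟨w, hwdef⟩ : ∃ w : ℝ → ℝ, w = fun R => u R * Real.sqrt (M R) := ⟨_, rfl⟩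
  have hsched_at : ∀ R, Ra ≤ R → Rb ≤ R → 0 < u R ∧ u R ≤ w R ∧ w R ≤ Real.sqrt θ * Real.sqrt R := by
    intro R hRRa hRRb
    obtain ⟨hu0, hu2⟩ := hua R hRRa
    obtain ⟨hM1, hM2⟩ := hMb R hRRb
    have hR0 : 0 ≤ R := hRa.le.trans hRRa
    have hMR0 : (0 : ℝ) ≤ (M R : ℝ) := Nat.cast_nonneg _
    have hsqM1 : 1 ≤ Real.sqrt (M R) := by
      rw [← Real.sqrt_one]
      exact Real.sqrt_le_sqrt (by exact_mod_cast hM1)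
    have hwR : w R = u R * Real.sqrt (M R) := by rw [hwdef]
    have huw : u R ≤ w R := by
      rw [hwR]
      calc u R = u R * 1 := (mul_one _).symm
        _ ≤ u R * Real.sqrt (M R) := mul_le_mul_of_nonneg_left hsqM1 hu0.le
    have hw0 : 0 < w R := hu0.trans_le huw
    have hwsq : w R ^ 2 = u R ^ 2 * (M R : ℝ) := by
      rw [hwR, mul_pow, Real.sq_sqrt hMR0]
    have hwle : w R ≤ Real.sqrt θ * Real.sqrt R := by
      have h1 : w R ^ 2 ≤ θ * R := by
        rw [hwsq]
        calc u R ^ 2 * (M R : ℝ) ≤ θ * Real.sqrt R * Real.sqrt R :=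
              mul_le_mul hu2 hM2 hMR0 (by positivity)
          _ = θ * R := by rw [mul_assoc, Real.mul_self_sqrt hR0]
      have h2 : Real.sqrt θ * Real.sqrt R = Real.sqrt (θ * R) := (Real.sqrt_mul hθ.le R).symm
      rw [h2, ← Real.sqrt_sq hw0.le]
      exact Real.sqrt_le_sqrt h1
    exact ⟨hu0, huw, hwle⟩
  have hsched : ChainSchedule θ u w :=
    ⟨max Ra Rb, fun R hR => hsched_at R ((le_max_left _ _).trans hR) ((le_max_right _ _).trans hR)⟩
  -- the three tails at ε/3
  obtain ⟨R₁, hR₁, hT1⟩ := huT (ε / 3) hε3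
  obtain ⟨R₂, hR₂, hT2⟩ := hMT (ε / 3) hε3
  obtain ⟨R₃, hR₃, hT3⟩ := h4 σ hσ hσ₄' T hT u w hsched (ε / 3) hε3
  -- the budget range
  obtain ⟨α, hαdef⟩ : ∃ α : ℝ, α = 4 * T * Real.sqrt θ := ⟨_, rfl⟩
  obtain ⟨β, hβdef⟩ : ∃ β : ℝ, β = 6 * σ + 4 * T * ‖u₀‖ + 2 := ⟨_, rfl⟩
  have hα : 0 ≤ α := by rw [hαdef]; positivity
  have hβ : 0 ≤ β := by rw [hβdef]; positivity
  refine ⟨max (max R₁ (max R₂ R₃)) (max (max Ra Rb) ((α + β + 1) ^ 2)),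
    hR₁.trans_le ((le_max_left _ _).trans (le_max_left _ _)), fun R hRge => ?_⟩
  have hRR₁ : R₁ ≤ R := ((le_max_left _ _).trans (le_max_left _ _)).trans hRge
  have hRR₂ : R₂ ≤ R := (((le_max_left _ _).trans (le_max_right _ _)).trans (le_max_left _ _)).trans hRge
  have hRR₃ : R₃ ≤ R := (((le_max_right _ _).trans (le_max_right _ _)).trans (le_max_left _ _)).trans hRge
  have hRRa : Ra ≤ R := (((le_max_left _ _).trans (le_max_left _ _)).trans (le_max_right _ _)).trans hRge
  have hRRb : Rb ≤ R := (((le_max_right _ _).trans (le_max_left _ _)).trans (le_max_right _ _)).trans hRge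
  have hRRc : (α + β + 1) ^ 2 ≤ R := ((le_max_right _ _).trans (le_max_right _ _)).trans hRge
  have hRpos : 0 < R := hR₁.trans_le hRR₁
  have hR0 : 0 ≤ R := hRpos.le
  obtain ⟨hu0, huw, hwle⟩ := hsched_at R hRRa hRRb
  have hw0 : 0 < w R := hu0.trans_le huw
  -- K and the budget
  obtain ⟨K, hKdef⟩ : ∃ K : ℕ, K = ⌈R / (4 * σ)⌉₊ := ⟨_, rfl⟩
  have hKge : R / (4 * σ) ≤ K := by rw [hKdef]; exact Nat.le_ceil _
  have hKle : (K : ℝ) ≤ R / (4 * σ) + 1 := by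
    rw [hKdef]; exact (Nat.ceil_lt_add_one (by positivity)).le
  have hbudget : ((K : ℝ) + 2) * σ + (u R + w R + 2 * ‖u₀‖) * T ≤ R := by
    have hmain : α * Real.sqrt R + β ≤ R := sqrt_budget' hα hβ hRRc
    have e1 : ((K : ℝ) + 2) * σ ≤ R / 4 + 3 * σ := by
      have : ((K : ℝ) + 2) * σ ≤ (R / (4 * σ) + 1 + 2) * σ := mul_le_mul_of_nonneg_right (by linarith) hσ.le
      refine this.trans (le_of_eq ?_)
      field_simp
      ring
    have e2 : (u R + w R + 2 * ‖u₀‖) * T ≤ (2 * (Real.sqrt θ * Real.sqrt R) + 2 * ‖u₀‖) * T :=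
      mul_le_mul_of_nonneg_right (by linarith) hT.le
    have e3 : (2 * (Real.sqrt θ * Real.sqrt R) + 2 * ‖u₀‖) * T = (α * Real.sqrt R + 4 * T * ‖u₀‖) / 2 := by
      rw [hαdef]; ring
    have e4 : R / 4 + 3 * σ + (α * Real.sqrt R + 4 * T * ‖u₀‖) / 2 ≤ R := by
      rw [hβdef] at hmain
      nlinarith [hmain, hR0]
    linarith [e1, e2, e3, e4]
  -- N₀
  obtain ⟨N₁, hN₁⟩ := hT1 R hRR₁
  obtain ⟨N₂, hN₂⟩ := hT2 R hRR₂
  obtain ⟨N₃, hN₃⟩ := hT3 R hRR₃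
  refine ⟨max N₁ (max N₂ N₃), fun N hN Φ Ψ => ?_⟩
  have hNN₁ : N₁ ≤ N := (le_max_left _ _).trans hN
  have hNN₂ : N₂ ≤ N := ((le_max_left _ _).trans (le_max_right _ _)).trans hN
  have hNN₃ : N₃ ≤ N := ((le_max_right _ _).trans (le_max_right _ _)).trans hN
  have hℓ : 0 < ell N := Real.rpow_pos_of_pos (by positivity) _
  set D : ℝ := haloMargin u₀ σ T (u R) with hDdef
  have hDpos : 0 < D := by rw [hDdef]; unfold haloMargin; positivity
  -- the three events
  set A : Fin (N + 1) → Set (Phase N) := fun i => {z | IsHot σ T N Φ u₀ (u R) (R + D) z i} with hAdef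
  set B : Fin (N + 1) → Set (Phase N) := fun i => {z | IsGathering σ T R N Ψ (M R) z i} with hBdef
  set C : Fin (N + 1) → Set (Phase N) := fun i =>
    {z | IsTightChain σ T N Φ (w R + ‖u₀‖) K z i ∧ ¬ IsHot σ T N Φ u₀ (u R) (R + D) z i} with hCdef
  -- (1) the a.e. covering
  have hae : ∀ᵐ z ∂(gibbs σ a θ u₀ N Φ), ∀ i, IsBad σ T R N Φ Ψ z i → z ∈ A i ∨ z ∈ B i ∨ z ∈ C i := by
    filter_upwards [hGood σ a θ u₀ N Φ Ψ R hσ hσhalf ha hθ,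
      hCov σ a θ u₀ N Φ Ψ T R (u R) (w R) D K hσ hσhalf ha hθ hT.le hu0 huw
        (by rw [hDdef]; unfold haloMargin; exact le_rfl) hbudget] with z hzgood hzcov
    intro i hbad
    by_cases hhoti : IsHot σ T N Φ u₀ (u R) (R + D) z i
    · exact Or.inl hhoti
    by_cases hgath : IsGathering σ T R N Ψ (M R) z i
    · exact Or.inr (Or.inl hgath)
    suffices hnf : ¬ IsForecastHot σ T R N Ψ u₀ (w R) z i from Or.inr (Or.inr ⟨hzcov i hbad hhoti hnf, hhoti⟩)
    -- no gathering + capped initial data ⇒ the forecast world of `i` is `w`-capped (energy domination)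
    rintro ⟨m, q, hq0, hq1, hfast⟩
    have hγ : IsHardSphereTrajectory G3 (hsDiameter σ N) (rangeCluster G3 (R * ell N) z i).card
        (forecastWorld σ R N Ψ z i) :=
      (Ψ (rangeCluster G3 (R * ell N) z i).card).isTrajectory _ (hzgood.2 i)
    have ht : (0 : ℝ) ≤ T * ell N * q := by
      have : (0 : ℝ) ≤ (q : ℝ) := by exact_mod_cast hq0
      positivity
    have hdom := hDom (rangeCluster G3 (R * ell N) z i).card (hsDiameter σ N)
      (forecastWorld σ R N Ψ z i) hγ u₀ m _ ht
    have hinit : ∀ a' : Fin (rangeCluster G3 (R * ell N) z i).card,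
        ‖(forecastWorld σ R N Ψ z i 0 a').2 - u₀‖ ^ 2 ≤ u R ^ 2 := by
      intro a'
      have h0 : forecastWorld σ R N Ψ z i 0 = Config.restrictTo (rangeCluster G3 (R * ell N) z i) z :=
        (Ψ (rangeCluster G3 (R * ell N) z i).card).flow_zero _ (hzgood.2 i)
      rw [h0, Config.restrictTo_apply]
      have hjS : (rangeCluster G3 (R * ell N) z i).orderEmbOfFin rfl a' ∈ rangeCluster G3 (R * ell N) z i :=
        Finset.orderEmbOfFin_mem _ rfl a'
      have hdist : Torus.euclidDist (z ((rangeCluster G3 (R * ell N) z i).orderEmbOfFin rfl a')).1 (z i).1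
          < (R + D) * ell N := by
        have hgap : R * ell N < (R + D) * ell N := by
          have := mul_pos hDpos hℓ
          linarith [add_mul R D (ell N)]
        rcases mem_rangeCluster_torus.1 hjS with hji | hle
        · rw [hji, Torus.euclidDist_self]
          exact lt_trans (mul_pos hRpos hℓ) hgap
        · rw [Torus.euclidDist_comm] at hle
          exact lt_of_le_of_lt hle hgap
      have hslow : ‖(z ((rangeCluster G3 (R * ell N) z i).orderEmbOfFin rfl a')).2 - u₀‖ ≤ u R := by
        by_contra hcon
        push Not at hcon
        refine hhoti ⟨(rangeCluster G3 (R * ell N) z i).orderEmbOfFin rfl a', 0, le_rfl, zero_le_one, ?_, ?_⟩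
        · simpa [Φ.flow_zero z hzgood.1] using hcon
        · simpa [Φ.flow_zero z hzgood.1] using hdist
      exact pow_le_pow_left₀ (norm_nonneg _) hslow 2
    have hcard : ((insert m (backwardCluster G3 (hsDiameter σ N) (forecastWorld σ R N Ψ z i) m 0
        (T * ell N * q))).card : ℝ) ≤ (M R : ℝ) := by
      have : (insert m (backwardCluster G3 (hsDiameter σ N) (forecastWorld σ R N Ψ z i) m 0
          (T * ell N * q))).card ≤ M R := by
        by_contra hcon
        push Not at hcon
        exact hgath ⟨m, q, hq0, hq1, hcon⟩
      exact_mod_cast this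
    have hwsq : w R ^ 2 = u R ^ 2 * (M R : ℝ) := by
      have hwR : w R = u R * Real.sqrt (M R) := by rw [hwdef]
      rw [hwR, mul_pow, Real.sq_sqrt (Nat.cast_nonneg _)]
    have hsq : ‖(forecastWorld σ R N Ψ z i (T * ell N * q) m).2 - u₀‖ ^ 2 ≤ w R ^ 2 := by
      refine hdom.trans ?_
      calc ∑ a' ∈ insert m (backwardCluster G3 (hsDiameter σ N) (forecastWorld σ R N Ψ z i) m 0
              (T * ell N * q)), ‖(forecastWorld σ R N Ψ z i 0 a').2 - u₀‖ ^ 2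
          ≤ ∑ _a' ∈ insert m (backwardCluster G3 (hsDiameter σ N) (forecastWorld σ R N Ψ z i) m 0
              (T * ell N * q)), u R ^ 2 := Finset.sum_le_sum fun a' _ => hinit a'
        _ = ((insert m (backwardCluster G3 (hsDiameter σ N) (forecastWorld σ R N Ψ z i) m 0
              (T * ell N * q))).card : ℝ) * u R ^ 2 := by
            rw [Finset.sum_const, nsmul_eq_mul]
        _ ≤ (M R : ℝ) * u R ^ 2 := mul_le_mul_of_nonneg_right hcard (sq_nonneg _)
        _ = w R ^ 2 := by rw [hwsq, mul_comm]
    have hle : ‖(forecastWorld σ R N Ψ z i (T * ell N * q) m).2 - u₀‖ ≤ w R :=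
      le_of_pow_le_pow_left₀ two_ne_zero hw0.le hsq
    exact (not_lt.2 hle) hfast
  -- (2) the three probabilities
  have hPA : ∀ i, gibbs σ a θ u₀ N Φ (A i) ≤ ENNReal.ofReal (ε / 3) := fun i => hN₁ N hNN₁ Φ i
  have hPB : ∀ i, gibbs σ a θ u₀ N Φ (B i) ≤ ENNReal.ofReal (ε / 3) := fun i => hN₂ N hNN₂ Φ Ψ i
  have hPC : ∀ i, gibbs σ a θ u₀ N Φ (C i) ≤ ENNReal.ofReal (ε / 3) := fun i =>
    hN₃ N hNN₃ Φ K hKge hbudget i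
  -- (3) integrate
  change ∫⁻ z, (badCount σ T R N Φ Ψ z : ℝ≥0∞) ∂(gibbs σ a θ u₀ N Φ) ≤ ENNReal.ofReal (ε * (N + 1))
  calc ∫⁻ z, (badCount σ T R N Φ Ψ z : ℝ≥0∞) ∂(gibbs σ a θ u₀ N Φ)
      ≤ ∫⁻ z, ∑ i : Fin (N + 1), ((toMeasurable (gibbs σ a θ u₀ N Φ) (A i)).indicator 1 z +
          (toMeasurable (gibbs σ a θ u₀ N Φ) (B i)).indicator 1 z +
          (toMeasurable (gibbs σ a θ u₀ N Φ) (C i)).indicator 1 z) ∂(gibbs σ a θ u₀ N Φ) :=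
        lintegral_mono_ae (hae.mono fun z hz => badCount_le_sum_indicator _ A B C hz)
    _ = ∑ i : Fin (N + 1), (gibbs σ a θ u₀ N Φ (A i) + gibbs σ a θ u₀ N Φ (B i) + gibbs σ a θ u₀ N Φ (C i)) :=
        lintegral_sum_indicator_eq _ A B C
    _ ≤ ∑ _i : Fin (N + 1), (ENNReal.ofReal (ε / 3) + ENNReal.ofReal (ε / 3) + ENNReal.ofReal (ε / 3)) :=
        Finset.sum_le_sum fun i _ => add_le_add (add_le_add (hPA i) (hPB i)) (hPC i)
    _ = ENNReal.ofReal (ε * (N + 1)) := by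
        rw [Finset.sum_const, Finset.card_univ, Fintype.card_fin, nsmul_eq_mul,
          ← ENNReal.ofReal_add hε3.le hε3.le, ← ENNReal.ofReal_add (by positivity) hε3.le,
          ← ENNReal.ofReal_natCast, ← ENNReal.ofReal_mul (Nat.cast_nonneg _)]
        congr 1
        push_cast
        ring

/-- **Registered goal `firstMoment_of_forecastCaps`**: the re-typed crux `FirstMomentInfluenceLocality` holds as soon as the
forecast cap `ForecastCapsExist` (`G_free`) does — every other input is landed (`stub_forecastWorldsGood`, `stub_energyDomination`,
`stub_anchoredCovering`, `stub_trueCapsExist`, `stub_tightChainTail`). -/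
theorem firstMoment_of_forecastCaps : ForecastCapsExist → FirstMomentInfluenceLocality := fun h =>
  firstMoment_of_stubs stub_forecastWorldsGood stub_energyDomination stub_anchoredCovering stub_trueCapsExist h
    stub_tightChainTail

end

end Summit.AtomisticToContinuum.HydrodynamicLimit.Theorems.TrueAnchoredInfection
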